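import Literature.MathematicalPhysics.QuantumFieldTheory.Balaban1983to89.B9Thm314GFlatV1Transfer
import Literature.MathematicalPhysics.QuantumFieldTheory.Balaban1983to89.B6HolderPairMemberV1

/-!
# `Balaban1983to89.B9Thm314GFlatV1Holder` — T. Bałaban, *Propagators for lattice gauge theories in a background field*,
# Commun. Math. Phys. **99** (1985) 389–434 [Balaban1985BackgroundPropagators], **THEOREM 3.14 (pp. 426–427, (3.154)) AT `U = 1` FOR THE
# GENUINE `k`-LEVEL `G = Δ_a⁻¹` ((2.19)/(2.22) of [4] = [Balaban1984PropagatorsII]) ON THE V1 TORUS: THE HÖLDER MEMBER (2.137)₁ (`∇G`, pair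
# difference) GIVEN THE ONE-FAMILY PAIR MAJORANTS** — for a pair of fine bonds `f₁, f₂` (`f₁ ∈ B(y)`), `supp μ ⊂ B′(y′)`, `|μ| ≤ B`:
# `|[(∇_νG[Ω]μ)(f₁) − (∇_νG[Ω]μ)(f₂)] − [(∇_νG[Ω′]μ)(f₁) − (∇_νG[Ω′]μ)(f₂)]| ≤ C·φ(y)·B·e^{−δ·min(d,d′)(y,y′)}·e^{−δ·d(y,y′,Ω)}` whenever the pair
# operators `P_{f₁,f₂}∇_νG[Ω]`, `P_{f₁,f₂}∇_νG[Ω′]` carry majorants `A₃·φ(a)·e^{−δ₃d(a,b)}`, `A₃·φ′(a)·e^{−δ₃d′(a,b)}` in their families with block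
# prefactors `φ, φ′ ≥ 0` agreeing at `y` (the printed shape of (2.137)₁ with the Hölder gain inside `φ`, p22's one-family lane) — FILE 2's
# general-prefactor engine `resolvent_diff_bound_gen`; theorems only; no existing module is touched; no definition, no fact is minted

statement-level skeleton of published theorems with citation tags; proofs where landed; nothing here is a claim about the Yang–Mills mass gap

PDF held: `paper:balaban1985-cmp99-background-propagators` (journal page = PDF page + 388), pp. 426–427 [PDF 38–39] (Theorem 3.14, (3.154): «If we
take a pair of operators constructed for the two sequences {Ω_j}, {Ω′_j}, then their difference satisfies all the inequalities characteristic for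
operators of the considered type, with the additional factor exp(−δ₀d(y,y′,Ω)) … (3.154)»); `paper:balaban1984-cmp96-propagators-rt-ii`
(journal page = PDF page + 222), p. 247 [PDF 25], render `1984-cmp96-propagators-rt-II-p025-x2.png` re-read this generation: Proposition 2.6,
(2.137) «‖ζ∇GJ‖_α, ‖ζG∇*J‖_α ≦ O(1)(Lʲη)^{1−α}(‖ζ‖_α^ξ + |ζ|)e^{−δ₃d(y,y′)}|J|, ξ = L^{−j} (2.137) for 0 ≦ α < 1, ζ ∈ C₀^∞(Δ̃(y)) (the cube Δ̃(y)
for y ∈ Λ_j is a sum of 2^d unit cubes on the L^{−j}-scale, having y as a corner), supp J ⊂ Δ(y′), with the constant O(1) depending on d, L and α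
(O(1) → ∞ if α → 1)»; [Balaban1984PropagatorsI] (1.109) p. 35 (the Hölder norm as a supremum of pair quotients).

CITATION HEADER (lean-in-tree rule) — WHAT IS REPRODUCED.  Phase-2 file of the `lit-balaban` typed skeleton (HOME `run/shared/lean/pub/lit-balaban/`),
unit `lit-balaban-p21` (proof seat p21, gen 23; B9 fold owner r06, referee ref-4); SKELETON row B9.Thm3.14 (member cell: Thm 3.14 at `U = 1` for the
genuine `k`-level `G = Δ_a⁻¹`, the Hölder member (2.137)₁ = B9 (3.43)-type entry, modulo the one-family input).  Companions: `B9Thm314GFlatV1Kernel`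
(FILE 1: resolvent identity, letters), `B9Thm314GFlatV1Transfer` (FILE 2: engine, (2.136)₁,₂ members), `B9Thm314GFlatV1MultiLevelTorus` ((2.136)₄),
`B9Thm314GFlatV1DivTransfer` ((2.136)₃, (2.140)₁₋₃).  The pair-difference operator `P_{f₁,f₂}` is p22's `B6HolderPairMemberV1.pairOp` BY NAME.

## WHAT THIS FILE CERTIFIES (kernel-checked)

* **`thm314_gradG_holder_flat_V1_of_majorants`** — THEOREM 3.14 AT `U = 1`, THE HÖLDER MEMBER (2.137)₁ FOR `G = Δ_a⁻¹` GIVEN THE ONE-FAMILY PAIR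
  MAJORANTS: for all `A₃ ≥ 0`, `δ₃ > 0` there are `δ, C, M₀ > 0`, `N₀ > 0` (on `d, L`, the weight band `[b₀, b₁]`, `A₃`, `δ₃` only) such that for every
  V1 torus, every pair of p21 torus families `D, D′` (hypotheses of FILE 2's `thm314_G_flat_V1` verbatim: `1 ≤ k`, `M_h = L^a ≥ 8`, `R ≥ 2L²`,
  `P_μ ≥ 5L`, `L ≥ 5`, `L·M_h ≥ M₀`, `R·L·M_h ≥ N₀ + 1`), `c_f ≠ 0`, positive weights in the global band agreeing on the common index bonds, common top
  blocks `y, y′`, a direction `ν`, fine bonds `f₁, f₂` with `f₁ ∈ B(y)`, block prefactors `φ ≥ 0` (family `{Ω_j}`), `φ′ ≥ 0` (family `{Ω′_j}`)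
  with `φ′(y) = φ(y)` such that the pair operators `P_{f₁,f₂}∘∇_ν∘G[Ω]` and `P_{f₁,f₂}∘∇_ν∘G[Ω′]` have the majorants `A₃·φ(a)·e^{−δ₃d(a,b)}` resp.
  `A₃·φ′(a)·e^{−δ₃d′(a,b)}` (`HasMajorant` in the two geometries), and `supp μ ⊂ B′(y′)`, `|μ| ≤ B`:
  `|[(∇_νG[Ω]μ)(f₁) − (∇_νG[Ω]μ)(f₂)] − [(∇_νG[Ω′]μ)(f₁) − (∇_νG[Ω′]μ)(f₂)]| ≤ C·φ(y)·B·e^{−δ·min(d(y,y′),d′(y,y′))}·e^{−δ·d(y,y′,Ω)}`,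
  `∇_ν = B6GradLegKLevelV1.DV ν c_f`, `G[Ω] = onFun (B6SectAVectorModelV1.GE (domT hN D hk) hcf hw)`.
  Mechanism: `P∘∇∘G − P∘∇∘G′ = (P∘∇∘G)∘(V_P + V_Q)∘G′` (FILE 1's `onFun_GE_sub` composed on the left), FILE 2's `resolvent_diff_bound_gen` with the
  outer prefactors `φ, φ′`, outer majorants = the hypotheses at the common rate, inner majorant = the (2.136)₁ majorant of `G′` (p38's
  `B6Prop26GradKLevelV1.prop26_2136_grad_kLevel_unconditional_pad_V1`, first conjunct, `α = ½`, `σ = σ₁`), the two-family (3.49)₄ difference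
  (gen 19's `thm314_P_flat_multiLevelTorus` member 4 through FILE 1's `member4_eq_dPd`), FILE 1's `dPd_le`, `w_le_of_band`, gen 18's
  `consts_260_261`; `(P_{f₁,f₂}T μ)(f₁) = (Tμ)(f₁) − (Tμ)(f₂)` is p22's `pairOp_apply`.  Inputs BY NAME, restating nothing.

## HONEST SCOPE

* The printed (2.137)₁ bounds the Hölder NORM `‖ζ∇GJ‖_α` of the localised function; this file treats, as the torus lineage does for `G′`
  (`B9Thm314GpFlatHolder`), the PAIR DIFFERENCE at two fine bonds `f₁, f₂` with `f₁` in the top block `B(y)` — the Hölder quotient, the factor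
  `(Lʲη)^{1−α}` and the admissible range of `(f₁, f₂)` all sit inside the GIVEN gain `φ` of the one-family majorants, which this file does NOT prove:
  the one-family (2.137)₁ pair majorants for the genuine `k`-level `G` are p22's lane (`B6HolderPairMemberV1`, `B6CubeHolderInDecayV1`,
  `B6HolderPairInputsV1`, … → `B6Ineq2137GradKLevelV1`); when they land with majorants `K(a,b) = A₃·g(a)·e^{−δ₃d(a,b)}` (`g ≥ 0`, e.g.
  `C_α·(|f₁−f₂|/L^{j(a)})^α·(L^{j(a)}|c_f|⁻¹)^{1−α}`), the hypotheses here are met with `φ := g`, `φ′ := g′` (same value on the common top block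
  `y`, where `j = k` in both families), if necessary through p22's `pairDiff_le_of_hasMajorant` + `hasMajorant_pairOp_mul` and
  `Module.End.mul_eq_comp`; the conclusion is then the printed two-family Hölder bound with the factor (3.154).  `C` does not depend on `φ`;
  `δ = ¼·min(δ₃, δ_G, δ₅, ρ)`.
* `U = 1`; the V1 torus model of the p21 lineage; the member (2.137)₂ (`G∇*`, whose inner factor carries the linear profile of
  `B9Thm314GFlatV1DivTransfer`) and (2.138)–(2.139) are NOT treated here.
* Nothing is inferred from the manuscript: every step is kernel-checked; the quoted sentences locate the statements.
-/

noncomputable section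

open scoped BigOperators Matrix
open Finset

namespace Literature.MathematicalPhysics.QuantumFieldTheory.Balaban1983to89.B9Thm314GFlatV1Holder

open B4Reflection242 (boxDom)
open B6MultiLevelBoxOperator (N0 aPrinted)
open B6MultiLevelTorusOperator (TDomains)
open B6Geom246MultiLevelBox (bset blkOf)
open B6Geom246MultiLevelTorus (geomT triangle_refl_nonneg_T)
open B6RandomWalk (HasMajorant BlockSupp hasMajorant_mono delta3 delta3_pos)
open B6Ineq2133TwoScaleV1 (onFun)
open B6SectAOperatorsV1 (BondIdx)
open B6SectAVectorModelV1 (GE)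
open B6GlobalChartV1 (PV blkV1 domT)
open B6Ineq288MultiLevelTorus (dPd)
open B6Ineq268MultiLevelBox (W W_pos)
open B9Thm314GpFlatTorusGeometry (dOmega dOmega_nonneg)
open B6Prop26KLevelSkeletonV1 (pref pref_nonneg)
open B6CubeWindowV1 (GlobalBand)
open B6GradLegKLevelV1 (DV)
open B6HolderPairMemberV1 (pairOp pairOp_apply)
open B9Thm314GpFlatMultiLevelTorus (consts_260_261)
open B6Prop26GradKLevelV1 (prop26_2136_grad_kLevel_unconditional_pad_V1)
open B9Thm314PFlatMultiLevelTorus (thm314_P_flat_multiLevelTorus)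
open B9Thm314GFlatV1Kernel (VP VQ onFun_GE_sub dPd_le member4_eq_dPd w_le_of_band)
open B9Thm314GFlatV1Transfer (resolvent_diff_bound_gen)

/-! ## THEOREM 3.14 AT `U = 1`: the Hölder member (2.137)₁ (`∇G`, pair difference) for `G = Δ_a⁻¹`, given the one-family pair majorants -/

/-- **THEOREM 3.14 AT `U = 1` — THE HÖLDER MEMBER (2.137)₁ (PAIR DIFFERENCE OF `∇_νG`) WITH THE FACTOR (3.154) FOR THE GENUINE `k`-LEVEL
`G = Δ_a⁻¹` OF TWO NESTED FAMILIES ON THE V1 TORUS, GIVEN THE ONE-FAMILY PAIR MAJORANTS**: for `A₃ ≥ 0`, `δ₃ > 0` there are `δ, C, M₀, N₀ > 0`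
such that, whenever `P_{f₁,f₂}∇_νG[Ω]` and `P_{f₁,f₂}∇_νG[Ω′]` carry the majorants `A₃φ(a)e^{−δ₃d(a,b)}`, `A₃φ′(a)e^{−δ₃d′(a,b)}` (`φ, φ′ ≥ 0`,
`φ′(y) = φ(y)`, `f₁ ∈ B(y)`), for `supp μ ⊂ B′(y′)`, `|μ| ≤ B`, `y, y′ ∈ Ω^{(k)}` common top blocks:
`|[(∇_νG[Ω]μ)(f₁) − (∇_νG[Ω]μ)(f₂)] − [(∇_νG[Ω′]μ)(f₁) − (∇_νG[Ω′]μ)(f₂)]| ≤ C·φ(y)·B·e^{−δ·min(d(y,y′), d′(y,y′))}·e^{−δ·d(y,y′,Ω)}`.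
[cite: Balaban1985BackgroundPropagators, Thm 3.14 (3.153)–(3.154) pp.426–427; Balaban1984PropagatorsII, Prop. 2.6 (2.137) p.247, (2.19)–(2.22) p.226;
Balaban1984PropagatorsI, (1.109) p.35] -/
theorem thm314_gradG_holder_flat_V1_of_majorants (d ℓ : ℕ) (hd : 1 ≤ d + 1) (hL : Odd (ℓ + 1) ∧ 1 < ℓ + 1) {b₀ b₁ : ℝ} (hb₀ : 0 < b₀)
    (hb₁ : b₀ ≤ b₁) {A₃ δ₃ : ℝ} (hA₃ : 0 ≤ A₃) (hδ₃ : 0 < δ₃) :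
    ∃ δ C M₀ : ℝ, ∃ N₀ : ℕ, 0 < δ ∧ 0 < C ∧ 0 < M₀ ∧ 0 < N₀ ∧
      ∀ (m K : ℕ) {Mh k R : ℕ} {P' : Fin (d + 1) → ℕ}
        (hN : ∀ μ, N0 ℓ Mh k P' μ = (PV d ℓ m K hd hL).sitesPerDir 0) (D D' : TDomains d ℓ Mh k P' R) (hk : k ≤ m + K),
        1 ≤ k → ∀ {a : ℕ}, Mh = (ℓ + 1) ^ a → 8 ≤ Mh → 2 * (ℓ + 1) ^ 2 ≤ R → (∀ μ, 5 * (ℓ + 1) ≤ P' μ) → 4 ≤ ℓ →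
        M₀ ≤ ((ℓ : ℝ) + 1) * Mh → N₀ + 1 ≤ R * ((ℓ + 1) * Mh) →
        ∀ {cf : ℝ} (hcf : cf ≠ 0) {w : BondIdx (domT hN D hk) → ℝ} (hw : ∀ i, 0 < w i)
          {w' : BondIdx (domT hN D' hk) → ℝ} (hw' : ∀ i', 0 < w' i'),
        GlobalBand b₀ b₁ cf w → GlobalBand b₀ b₁ cf w' →
        (∀ (i : BondIdx (domT hN D hk)) (i' : BondIdx (domT hN D' hk)), i.1 = i'.1 → w i = w' i') →
        ∀ (y : ↥(bset D.toDomains)) (hyD' : y.1 ∈ bset D'.toDomains) (y' : ↥(bset D'.toDomains)) (hy'D : y'.1 ∈ bset D.toDomains),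
        y.1.1 = k → y'.1.1 = k →
        ∀ (ν : Fin (d + 1)) (f₁ f₂ : PBond (PV d ℓ m K hd hL) 0) (φ : ↥(bset D.toDomains) → ℝ) (φ' : ↥(bset D'.toDomains) → ℝ),
        (∀ a, 0 ≤ φ a) → (∀ a', 0 ≤ φ' a') → φ' ⟨y.1, hyD'⟩ = φ y →
        HasMajorant (g := geomT D) (blkV1 hN D) (pairOp f₁ f₂ ∘ₗ (DV ν cf ∘ₗ onFun (GE (domT hN D hk) hcf hw)))
            (fun a b => A₃ * φ a * Real.exp (-(δ₃ * (geomT D).dist a b))) →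
        HasMajorant (g := geomT D') (blkV1 hN D') (pairOp f₁ f₂ ∘ₗ (DV ν cf ∘ₗ onFun (GE (domT hN D' hk) hcf hw')))
            (fun a b => A₃ * φ' a * Real.exp (-(δ₃ * (geomT D').dist a b))) →
        ∀ (μ : PBond (PV d ℓ m K hd hL) 0 → ℝ) (B : ℝ), BlockSupp (g := geomT D') (blkV1 hN D') μ y' B →
        blkV1 hN D f₁ = y →
          |((DV ν cf ∘ₗ onFun (GE (domT hN D hk) hcf hw)) μ f₁ - (DV ν cf ∘ₗ onFun (GE (domT hN D hk) hcf hw)) μ f₂)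
              - ((DV ν cf ∘ₗ onFun (GE (domT hN D' hk) hcf hw')) μ f₁ - (DV ν cf ∘ₗ onFun (GE (domT hN D' hk) hcf hw')) μ f₂)|
            ≤ C * (φ y * B)
              * Real.exp (-(δ * min ((geomT D).dist y ⟨y'.1, hy'D⟩) ((geomT D').dist ⟨y.1, hyD'⟩ y')))
              * Real.exp (-(δ * dOmega D D' y.1.2 y'.1.2)) := by
  have hℓ : 1 ≤ ℓ := by have := hL.2; omega
  have hL1 : (1 : ℝ) ≤ (ℓ : ℝ) + 1 := by linarith [(Nat.cast_nonneg ℓ : (0 : ℝ) ≤ ℓ)]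
  -- (2.136)₁ for `G = Δ_a⁻¹` (p38), at `α = ½`, `σ = σ₁`: the inner factor's majorant
  obtain ⟨σ₁, hσ₁, hT1⟩ := prop26_2136_grad_kLevel_unconditional_pad_V1 d ℓ hd hL hb₀ hb₁
  obtain ⟨A, M₂, hA, hM₂, hG1⟩ := hT1 σ₁ hσ₁ le_rfl (1 / 2) (by norm_num) (by norm_num)
  have hδG0 : 0 < delta3 (1 / 2) (2 * σ₁) := delta3_pos (by norm_num) (by linarith)
  -- the two-family (3.49)₄ difference (gen 19) and the one-family (3.49)₄ (FILE 1) at the printed weights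
  have hL2 : (1 : ℝ) < (((ℓ : ℝ) + 1)) ^ 2 := by
    have : (2 : ℝ) ≤ (ℓ : ℝ) + 1 := by
      have : (1 : ℝ) ≤ ℓ := by exact_mod_cast hℓ
      linarith
    nlinarith
  have hamin : 0 < 1 - ((((ℓ : ℝ) + 1)) ^ 2)⁻¹ := by rw [sub_pos]; exact inv_lt_one_of_one_lt₀ hL2
  obtain ⟨hwin, hrec⟩ := B6Prop22KLevelCensus.KIdx.aPrinted_windows hℓ
  obtain ⟨δ₅, C₅, M₅, N₅, hδ₅, hC₅, hM₅, hN₅, h5⟩ :=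
    thm314_P_flat_multiLevelTorus d ℓ hℓ (1 - ((((ℓ : ℝ) + 1)) ^ 2)⁻¹) 1 1 1 hamin one_pos
  obtain ⟨ρ, BP, MP, NP, hρ, hBP, hMP, hNP, hPk⟩ := dPd_le d ℓ hℓ
  -- the common rate (below the GIVEN rate `δ₃` as well) and the thresholds of (2.60)/(2.61)
  obtain ⟨δ, hδ0, hδ3, hδG, hδ5, hδρ⟩ : ∃ δ : ℝ, 0 < δ ∧ δ ≤ δ₃ ∧ δ ≤ delta3 (1 / 2) (2 * σ₁) ∧ δ ≤ δ₅ ∧ δ ≤ ρ :=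
    ⟨min (min δ₃ (delta3 (1 / 2) (2 * σ₁))) (min δ₅ ρ), lt_min (lt_min hδ₃ hδG0) (lt_min hδ₅ hρ),
      (min_le_left _ _).trans (min_le_left _ _), (min_le_left _ _).trans (min_le_right _ _),
      (min_le_right _ _).trans (min_le_left _ _), (min_le_right _ _).trans (min_le_right _ _)⟩
  obtain ⟨Nc, c, hNc, hc, hcon⟩ := consts_260_261 d ℓ hδ0
  have hb₁0 : 0 ≤ b₁ := hb₀.le.trans hb₁
  refine ⟨δ / 4, (Real.sqrt (2 * A₃) * Real.sqrt ((((d : ℝ) + 1) * c * (C₅ + BP * Real.exp (2 * δ) * (1 + ((ℓ : ℝ) + 1) ^ 2)) + 2 * b₁ * Real.exp (5 / 2 * δ) * (1 + ((ℓ : ℝ) + 1) ^ 2)) * ((ℓ : ℝ) + 1) ^ 2 * c * (A₃ * A)) + 1), max M₂ (max M₅ MP), max Nc (max N₅ NP), by positivity, by positivity, lt_max_of_lt_left hM₂,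
    lt_max_of_lt_left hNc, ?_⟩
  intro m K Mh k R P' hN D D' hk hk1 a hMha hM8 hR2 hP5 hℓ4 hM hRN cf hcf w hw w' hw' hwb hwb' hww y hyD' y' hy'D hy hy' ν f₁ f₂ φ φ' hφ0 hφ0' hφ
    hH hH' μ B hμ hf₁
  -- sizes
  have hMh1 : 1 ≤ Mh := by omega
  have hMh3 : 3 ≤ Mh := by omega
  have hP1 : ∀ μ, 1 ≤ P' μ := fun μ => le_trans (by omega) (hP5 μ)
  have hP4 : ∀ μ, 4 ≤ P' μ := fun μ => le_trans (by omega) (hP5 μ)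
  have hR2' : 2 * (ℓ + 1) ≤ R := le_trans (Nat.mul_le_mul_left 2 (by rw [pow_two]; exact Nat.le_mul_self _)) hR2
  have hRM1 : 1 ≤ R * ((ℓ + 1) * Mh) := le_trans (Nat.le_add_left 1 _) hRN
  have hM2' : M₂ ≤ ((ℓ : ℝ) + 1) * Mh := (le_max_left _ _).trans hM
  have hM5' : M₅ ≤ ((ℓ : ℝ) + 1) * Mh := ((le_max_left _ _).trans (le_max_right _ _)).trans hM
  have hMP' : MP ≤ ((ℓ : ℝ) + 1) * Mh := ((le_max_right _ _).trans (le_max_right _ _)).trans hM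
  have hNc' : Nc + 1 ≤ R * ((ℓ + 1) * Mh) := le_trans (Nat.succ_le_succ (le_max_left _ _)) hRN
  have hN5' : N₅ + 1 ≤ R * ((ℓ + 1) * Mh) := le_trans (Nat.succ_le_succ ((le_max_left _ _).trans (le_max_right _ _))) hRN
  have hNP' : NP + 1 ≤ R * ((ℓ + 1) * Mh) := le_trans (Nat.succ_le_succ ((le_max_right _ _).trans (le_max_right _ _))) hRN
  obtain ⟨hthr, h261⟩ := hcon k Mh R P' hMh1 hP1 hNc'
  have hd0 : ∀ s t : ↥(bset D.toDomains), 0 ≤ (geomT D).dist s t := (triangle_refl_nonneg_T D hMh1 hP1).2.2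
  have hd0' : ∀ s t : ↥(bset D'.toDomains), 0 ≤ (geomT D').dist s t := (triangle_refl_nonneg_T D' hMh1 hP1).2.2
  -- the GIVEN pair majorants of the two outer operators, and the (2.136)₁ majorant of the inner factor, at the common rate
  have hT1D' := hG1 m K hN D' hk hk1 hMha hM8 hR2 hP5 hℓ4 hM2' hcf hw' hwb'
  have hT : HasMajorant (g := geomT D) (blkV1 hN D) (pairOp f₁ f₂ ∘ₗ (DV ν cf ∘ₗ onFun (GE (domT hN D hk) hcf hw)))
      (fun a b => A₃ * φ a * Real.exp (-(δ * (geomT D).dist a b))) :=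
    hasMajorant_mono (g := geomT D) (blkV1 hN D) hH fun a b =>
      mul_le_mul_of_nonneg_left (Real.exp_le_exp.2 (neg_le_neg (mul_le_mul_of_nonneg_right hδ3 (hd0 a b)))) (mul_nonneg hA₃ (hφ0 a))
  have hT' : HasMajorant (g := geomT D') (blkV1 hN D') (pairOp f₁ f₂ ∘ₗ (DV ν cf ∘ₗ onFun (GE (domT hN D' hk) hcf hw')))
      (fun a b => A₃ * φ' a * Real.exp (-(δ * (geomT D').dist a b))) :=
    hasMajorant_mono (g := geomT D') (blkV1 hN D') hH' fun a b =>
      mul_le_mul_of_nonneg_left (Real.exp_le_exp.2 (neg_le_neg (mul_le_mul_of_nonneg_right hδ3 (hd0' a b)))) (mul_nonneg hA₃ (hφ0' a))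
  have hG' : HasMajorant (g := geomT D') (blkV1 hN D') (onFun (GE (domT hN D' hk) hcf hw'))
      (fun a b => A * pref cf a * Real.exp (-(δ * (geomT D').dist a b))) :=
    hasMajorant_mono (g := geomT D') (blkV1 hN D') hT1D'.1 fun a b =>
      mul_le_mul_of_nonneg_left (Real.exp_le_exp.2 (neg_le_neg (mul_le_mul_of_nonneg_right hδG (hd0' a b))))
        (mul_nonneg hA (pref_nonneg _ _))
  -- the resolvent identity composed with `P_{f₁,f₂}∘∇_ν` on the left
  have hres : pairOp f₁ f₂ ∘ₗ (DV ν cf ∘ₗ onFun (GE (domT hN D hk) hcf hw)) - pairOp f₁ f₂ ∘ₗ (DV ν cf ∘ₗ onFun (GE (domT hN D' hk) hcf hw'))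
      = (pairOp f₁ f₂ ∘ₗ (DV ν cf ∘ₗ onFun (GE (domT hN D hk) hcf hw))) ∘ₗ (VP hN D D' cf + VQ hN D D' hk w w')
          ∘ₗ onFun (GE (domT hN D' hk) hcf hw') := by
    rw [← LinearMap.comp_sub, ← LinearMap.comp_sub, onFun_GE_sub hN D D' hk hℓ hMh1 hP1 hcf hw hw', LinearMap.comp_assoc,
      LinearMap.comp_assoc]
  -- the two-family (3.49)₄ difference at the common rate
  have hΔ : ∀ (p q : ℕ × (Fin (d + 1) → ℤ)) (hpD : p ∈ bset D.toDomains) (hpD' : p ∈ bset D'.toDomains)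
      (hqD : q ∈ bset D.toDomains) (hqD' : q ∈ bset D'.toDomains), p.1 = k → q.1 = k →
      ∀ (x x' : ↥(boxDom (N0 ℓ Mh k P'))), blkOf D.toDomains x = ⟨p, hpD⟩ → blkOf D.toDomains x' = ⟨q, hqD⟩ →
      ∀ μ ν : Fin (d + 1), |dPd D μ ν x x' - dPd D' μ ν x x'|
        ≤ C₅ * ((((ℓ : ℝ) + 1) ^ k) ^ 2)⁻¹ * ((((ℓ : ℝ) + 1) ^ k) ^ (d + 1))⁻¹
          * Real.exp (-(δ * min ((geomT D).dist ⟨p, hpD⟩ ⟨q, hqD⟩) ((geomT D').dist ⟨p, hpD'⟩ ⟨q, hqD'⟩)))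
          * Real.exp (-(δ * dOmega D D' p.2 q.2)) := by
    intro p q hpD hpD' hqD hqD' hp hq x₁ x₂ hx₁ hx₂ μ₁ ν₁
    obtain ⟨-, -, -, h4⟩ := h5 k Mh R hMh3 hM5' hR2' hN5' P' hP1 hP4 D D' (aPrinted ℓ 1) (fun _ => 1) hwin
      (fun i _ => ⟨le_rfl, le_rfl⟩) hrec p q hpD hpD' hqD hqD' hp hq x₁ x₂ hx₁ hx₂
    have h := h4 μ₁ ν₁
    rw [member4_eq_dPd, member4_eq_dPd] at h
    refine h.trans ?_
    have h0 : 0 ≤ C₅ * ((((ℓ : ℝ) + 1) ^ k) ^ 2)⁻¹ * ((((ℓ : ℝ) + 1) ^ k) ^ (d + 1))⁻¹ := by positivity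
    have hm0 : 0 ≤ min ((geomT D).dist ⟨p, hpD⟩ ⟨q, hqD⟩) ((geomT D').dist ⟨p, hpD'⟩ ⟨q, hqD'⟩) := le_min (hd0 _ _) (hd0' _ _)
    have hΩ0 : 0 ≤ dOmega D D' p.2 q.2 := dOmega_nonneg D D' _ _
    have e1 : Real.exp (-(δ₅ * min ((geomT D).dist ⟨p, hpD⟩ ⟨q, hqD⟩) ((geomT D').dist ⟨p, hpD'⟩ ⟨q, hqD'⟩)))
        ≤ Real.exp (-(δ * min ((geomT D).dist ⟨p, hpD⟩ ⟨q, hqD⟩) ((geomT D').dist ⟨p, hpD'⟩ ⟨q, hqD'⟩))) :=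
      Real.exp_le_exp.2 (neg_le_neg (mul_le_mul_of_nonneg_right hδ5 hm0))
    have e2 : Real.exp (-(δ₅ * dOmega D D' p.2 q.2)) ≤ Real.exp (-(δ * dOmega D D' p.2 q.2)) :=
      Real.exp_le_exp.2 (neg_le_neg (mul_le_mul_of_nonneg_right hδ5 hΩ0))
    exact mul_le_mul (mul_le_mul_of_nonneg_left e1 h0) e2 (Real.exp_pos _).le (mul_nonneg h0 (Real.exp_pos _).le)
  -- the one-family (3.49)₄ bounds at the common rate
  have hPD : ∀ (μ ν : Fin (d + 1)) (x x' : ↥(boxDom (N0 ℓ Mh k P'))),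
      |dPd D μ ν x x'| ≤ BP * ((((ℓ : ℝ) + 1) ^ D.lev x.1) ^ 2)⁻¹ * (W D.toDomains (blkOf D.toDomains x'))⁻¹ *
        Real.exp (-(δ * (geomT D).dist (blkOf D.toDomains x) (blkOf D.toDomains x'))) := by
    intro μ₁ ν₁ x₁ x₂
    refine (hPk k Mh R hMh3 hMP' hR2' hNP' P' hP4 D μ₁ ν₁ x₁ x₂).trans ?_
    have hW0 : 0 < W D.toDomains (blkOf D.toDomains x₂) := W_pos _ _
    exact mul_le_mul_of_nonneg_left (Real.exp_le_exp.2 (neg_le_neg (mul_le_mul_of_nonneg_right hδρ (hd0 _ _)))) (by positivity)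
  have hPD' : ∀ (μ ν : Fin (d + 1)) (x x' : ↥(boxDom (N0 ℓ Mh k P'))),
      |dPd D' μ ν x x'| ≤ BP * ((((ℓ : ℝ) + 1) ^ D'.lev x.1) ^ 2)⁻¹ * (W D'.toDomains (blkOf D'.toDomains x'))⁻¹ *
        Real.exp (-(δ * (geomT D').dist (blkOf D'.toDomains x) (blkOf D'.toDomains x'))) := by
    intro μ₁ ν₁ x₁ x₂
    refine (hPk k Mh R hMh3 hMP' hR2' hNP' P' hP4 D' μ₁ ν₁ x₁ x₂).trans ?_
    have hW0 : 0 < W D'.toDomains (blkOf D'.toDomains x₂) := W_pos _ _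
    exact mul_le_mul_of_nonneg_left (Real.exp_le_exp.2 (neg_le_neg (mul_le_mul_of_nonneg_right hδρ (hd0' _ _)))) (by positivity)
  -- the weights
  have hw0 : ∀ i, 0 ≤ w i := fun i => (hw i).le
  have hw0' : ∀ i', 0 ≤ w' i' := fun i' => (hw' i').le
  have hwB := fun i => w_le_of_band hN D hk hcf hwb i
  have hwB' := fun i' => w_le_of_band hN D' hk hcf hwb' i'
  -- FILE 2's abstract theorem with the outer prefactors `φ, φ′`
  have hmain := resolvent_diff_bound_gen hN D D' hk hk1 hMh1 hP1 hRM1 hδ0.le hcf hC₅.le hBP.le hb₁0 hA hμ.nonneg hc hthr (h261 D) (h261 D')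
    hΔ hPD hPD' hw0 hw0' hwB hwB' hww hA₃ (φ := φ) (φ' := φ')
    hφ0 hT hT' hG' hres hy hyD' hy' hy'D hφ hμ f₁ hf₁
  -- `(P_{f₁,f₂}T μ)(f₁) = (Tμ)(f₁) − (Tμ)(f₂)`
  have eP : ∀ S : (PBond (PV d ℓ m K hd hL) 0 → ℝ) →ₗ[ℝ] (PBond (PV d ℓ m K hd hL) 0 → ℝ),
      (pairOp f₁ f₂ ∘ₗ S) μ f₁ = S μ f₁ - S μ f₂ := fun S => by
    rw [LinearMap.comp_apply, pairOp_apply, if_pos rfl]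
  rw [eP, eP] at hmain
  refine hmain.trans ?_
  -- the rates `½δ`, `¼δ` weakened to `δ/4`, the constant enlarged by `1`
  have hF : 0 ≤ φ y * B := mul_nonneg (hφ0 y) hμ.nonneg
  have hm0 : 0 ≤ min ((geomT D).dist y ⟨y'.1, hy'D⟩) ((geomT D').dist ⟨y.1, hyD'⟩ y') := le_min (hd0 _ _) (hd0' _ _)
  have e1 : Real.exp (-(1 / 2 * δ * min ((geomT D).dist y ⟨y'.1, hy'D⟩) ((geomT D').dist ⟨y.1, hyD'⟩ y')))
      ≤ Real.exp (-(δ / 4 * min ((geomT D).dist y ⟨y'.1, hy'D⟩) ((geomT D').dist ⟨y.1, hyD'⟩ y'))) :=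
    Real.exp_le_exp.2 (by nlinarith [mul_nonneg hδ0.le hm0])
  have e2 : Real.exp (-(1 / 4 * δ * dOmega D D' y.1.2 y'.1.2)) = Real.exp (-(δ / 4 * dOmega D D' y.1.2 y'.1.2)) := by
    congr 1; ring
  have hK0 : 0 ≤ Real.sqrt (2 * A₃) * Real.sqrt ((((d : ℝ) + 1) * c * (C₅ + BP * Real.exp (2 * δ) * (1 + ((ℓ : ℝ) + 1) ^ 2)) + 2 * b₁ * Real.exp (5 / 2 * δ) * (1 + ((ℓ : ℝ) + 1) ^ 2)) * ((ℓ : ℝ) + 1) ^ 2 * c * (A₃ * A)) :=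
    mul_nonneg (Real.sqrt_nonneg _) (Real.sqrt_nonneg _)
  have hK1 : Real.sqrt (2 * A₃) * Real.sqrt ((((d : ℝ) + 1) * c * (C₅ + BP * Real.exp (2 * δ) * (1 + ((ℓ : ℝ) + 1) ^ 2)) + 2 * b₁ * Real.exp (5 / 2 * δ) * (1 + ((ℓ : ℝ) + 1) ^ 2)) * ((ℓ : ℝ) + 1) ^ 2 * c * (A₃ * A)) ≤ (Real.sqrt (2 * A₃) * Real.sqrt ((((d : ℝ) + 1) * c * (C₅ + BP * Real.exp (2 * δ) * (1 + ((ℓ : ℝ) + 1) ^ 2)) + 2 * b₁ * Real.exp (5 / 2 * δ) * (1 + ((ℓ : ℝ) + 1) ^ 2)) * ((ℓ : ℝ) + 1) ^ 2 * c * (A₃ * A)) + 1) := le_add_of_nonneg_right zero_le_one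
  rw [e2]
  exact mul_le_mul (mul_le_mul (mul_le_mul_of_nonneg_right hK1 hF) e1 (Real.exp_pos _).le
    (mul_nonneg (hK0.trans hK1) hF)) le_rfl (Real.exp_pos _).le
    (mul_nonneg (mul_nonneg (hK0.trans hK1) hF) (Real.exp_pos _).le)

end Literature.MathematicalPhysics.QuantumFieldTheory.Balaban1983to89.B9Thm314GFlatV1Holder

end
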